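import Summits.BirchSwinnertonDyer.BirchSwinnertonDyer.Theorems.PoitouTateSelmerStructureDualityConjHolds
import Summits.BirchSwinnertonDyer.BirchSwinnertonDyer.Theorems.PrintX10bHowardSettingSatisfiesHERed
import Literature.NumberTheory.EllipticCurves.ZpExtensionEisensteinDVRSettingH4BadPlacesUniformProofs
import Literature.NumberTheory.EllipticCurves.ZpExtensionEisensteinDVRSettingH4OrdinaryProofs
import Literature.NumberTheory.EllipticCurves.ZpExtensionEisensteinDVRSettingH4OrdinaryIsotropyProofs
import Literature.NumberTheory.EllipticCurves.AnticyclotomicHeegnerPlacesDecompositionProofs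
import Literature.NumberTheory.EllipticCurves.ZpExtensionEisensteinBadSetProofs
import Literature.NumberTheory.EllipticCurves.ZpExtensionEisensteinKolyvaginPrimesDepthProofs
import Literature.NumberTheory.EllipticCurves.LambdaAdicSelmerDataToEisensteinH1Linear
import Summits.BirchSwinnertonDyer.BirchSwinnertonDyer.Theorems.PrintX9MuPartStabilizedCoherentPairOfCyclic
import HarnessLib

/-!
# STUB A of the shared μ-item — `Stmt.h4AtS` (H.4 at the places of `S`) from (Exact) at `v ∣ p` (D1 custodian, x10b-p1 LEAD g8)

Helper toward the registered stub `stub_h4AtS` of the shared deciding μ-item (`MuInequalityCoherentPairOfPrintCG`,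
stmt-BirchSwinnertonDyer-23428; earlier keys 23237 / 23088 / 22642).  The letters `Stmt.poitouTate`, `Stmt.h4AtS`,
`Stmt.exactAtP` are the D1 assembly v3 letters (tree `Cruxes/BeyondCarrierDepthX10b/D1_STUB_A_ASSEMBLY_x10b_p1_g8.lean`,
commit 1bc7e550c580) — `Stmt.h4AtS` carries the `he_red` binder right after clause (1).  The theorem
`h4AtS_of_exactAtP` reduces H.4 at every `v ∈ S` to the two (Exact) clauses at the places `v ∣ p`, by the landed kernel
theorems: `eisensteinTower_exists_forall_isSelfOrthogonalAt_of_not_mem` (v ∤ p, p667675),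
`eisensteinTower_isSelfOrthogonalAt_of_mem` (v ∣ p glue, p669585), `eisensteinTower_orthogonal_twistedFil_of_e_eq`
(isotropy, p670038); `h4AtS_of_exactAtP'` also discharges the Poitou–Tate binder by
`InputsPoitouTateSelmer.poitouTate_selmerStructure_duality_conj_holds`.  Bookkeeping toward one stub of one crux;
no summit statement is proved here; BSD is not proved by any of this.
-/

set_option linter.dupNamespace false
set_option autoImplicit false

noncomputable section

open scoped Classical Pointwise ContRepresentation TensorProduct NumberField

open Function NumberField IsDedekindDomain Field
open Literature Literature.NumberTheory.EllipticCurves WeierstrassCurve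
open Literature.NumberTheory.GaloisCohomology Literature.NumberTheory.GaloisCohomology.Howard2004
open Literature.NumberTheory.GaloisRepresentations Literature.NumberTheory.GaloisRepresentations.DiscreteGaloisModule
open Literature.NumberTheory.Automorphic
open Literature.NumberTheory.EllipticCurves.ZpExtension (EisensteinLevel)
open Summit.BirchSwinnertonDyer.BirchSwinnertonDyer.Theorems


namespace Summit.BirchSwinnertonDyer.BirchSwinnertonDyer.Theorems.HeegnerMuPartH4AtS


/-- INPUT 1 — the Poitou–Tate named fact (binder). -/
abbrev Stmt.poitouTate : Prop :=
  ∀ (K : Type) [Field K] [NumberField K], poitouTate_selmerStructure_duality K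

set_option synthInstance.maxHeartbeats 80000 in
/-- INPUT 2 — **H.4 at the places of `S`** (`S` containing the places above `p`, contained in the places above `pN`, `Aut(K/ℚ)`-stable)
for the instantiated H.4 data (canonical conjugation datum), `m ≫ 0` depending on `S` only.  The binders after `m` are exactly the data/identities exported by `exists_eisensteinSettingData_satisfiesH_of_thm413Hypotheses`. -/
abbrev Stmt.h4AtS : Prop :=
  ∀ (N : ℕ) [NeZero N] (W : WeierstrassCurve ℚ) [W.IsGloballyMinimal] (K : Type) [Field K] [NumberField K]
    (p : ℕ) [Fact p.Prime] (κ : ZpExtension K p) (γ : Field.absoluteGaloisGroup K)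
    (hyp : CastellaGrossiLeeSkinner2022.Thm413Hypotheses N W K p κ γ),
    W.HasIrreducibleModPGaloisRep p → (W.baseChange K).HasIrreducibleModPGaloisRep p →
    haveI := hyp.isElliptic
    ∀ (S : Finset (HeightOneSpectrum (𝓞 K)))
      (hpS : ∀ v, ((p : ℕ) : 𝓞 K) ∈ v.asIdeal → v ∈ S)
      (hbad : ∀ v, v ∉ S → ((p : ℕ) : 𝓞 K) ∉ v.asIdeal → (W.baseChange K).HasGoodReductionAt v),
    (∀ v ∈ S, ((p : ℕ) : 𝓞 K) ∈ v.asIdeal ∨ ((N : ℕ) : 𝓞 K) ∈ v.asIdeal) →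
    (∀ (σ : K ≃ₐ[ℚ] K) (v : HeightOneSpectrum (𝓞 K)), σ • v ∈ S → v ∈ S) →
    ∃ m₄ : ℕ, ∀ (m : ℕ) (hm : 1 ≤ m), m₄ ≤ m →
      letI := IwasawaAlgebra.isDomain_quotient_X_pow_add_C p hm
      letI := IwasawaAlgebra.isDiscreteValuationRing_quotient_X_pow_add_C p hm
      haveI := IwasawaAlgebra.EisensteinCoeff.isLocalRing_succ p hm
      letI := IwasawaAlgebra.EisensteinCoeff.algebraOfSpecSucc p m
      haveI := W.isScalarTower_algebraOfSpecSucc (K := K) (p := p) (m := m)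
      letI := W.residueModuleSucc (K := K) (p := p) hm
      ∀ (L : Set (HeightOneSpectrum (𝓞 K)))
        (hL : L ⊆ (W.eisensteinTower (κ.unitTwist (-1)) hm).degreeTwoPrimes p) (hLS : ∀ v ∈ L, v ∉ S)
        (c₀ : absoluteGaloisGroup ℚ) (σ : K ≃ₐ[ℚ] K) (hσ₁ : σ ≠ 1) (hσ : σ * σ = 1)
        (hτl : IsLiftOfAut σ (absGaloisTransport (K := ℚ) (L := K) c₀).toRingEquiv)
        (hτ₂ : Function.Involutive (absGaloisTransport (K := ℚ) (L := K) c₀).toRingEquiv)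
        (D : ∀ k, DualityDatum p (ConjugationDatum.ofLifts σ hσ₁ hσ _ hτl hτ₂)
          ((W.eisensteinTower (κ.unitTwist (-1)) hm).ρ k) (IwasawaAlgebra.EisensteinCoeff p m (k + 1)))
        (e : ∀ j : ℕ, geomTorsion (W.baseChange K) ((p : ℤ) ^ j) →+ geomTorsion (W.baseChange K) ((p : ℤ) ^ j) →+
          MuCarrier K (p ^ j))
        (log : ∀ j : ℕ, MuCarrier K (p ^ j) →+ ZMod (p ^ j)),
        IsComplexConjugation (Rat.castHom ℝ) c₀ →
        (∀ x, (ConjugationDatum.ofLifts σ hσ₁ hσ _ hτl hτ₂).τ x = absGaloisTransport (K := ℚ) (L := K) c₀ x) →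
        (∀ k, (D k).e = ZpExtension.eisensteinDualityForm hm (k + 1)
          (conjPairing (e (k + 1)) ((ConjugationDatum.ofLifts σ hσ₁ hσ _ hτl hτ₂).isLift.torsionMap W _)
            (log (k + 1)))) →
        (∀ k (x y : EisensteinLevel p m (fun j ↦ geomTorsion (W.baseChange K) ((p : ℤ) ^ j)) (k + 1 + 1)),
          IwasawaAlgebra.EisensteinCoeff.reduce p m (Nat.le_succ (k + 1)) ((D (k + 1)).e x y) =
            (D k).e ((W.eisensteinTower (κ.unitTwist (-1)) hm).red k x) ((W.eisensteinTower (κ.unitTwist (-1)) hm).red k y)) →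
        (∀ j a, e j a a = 0) →
        (∀ j (g : absoluteGaloisGroup K) a b, e j (g • a) (g • b) = mu K (p ^ j) g (e j a b)) →
        (∀ j a b, e j ((ConjugationDatum.ofLifts σ hσ₁ hσ _ hτl hτ₂).isLift.torsionMap W _ a)
          ((ConjugationDatum.ofLifts σ hσ₁ hσ _ hτl hτ₂).isLift.torsionMap W _ b) = -e j a b) →
        (∀ j (a : geomTorsion (W.baseChange K) ((p : ℤ) ^ j)),
          (ConjugationDatum.ofLifts σ hσ₁ hσ _ hτl hτ₂).isLift.torsionMap W _
            ((ConjugationDatum.ofLifts σ hσ₁ hσ _ hτl hτ₂).isLift.torsionMap W _ a) = a) →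
        (∀ j, Function.Bijective (log j)) →
        (∀ j (g : absoluteGaloisGroup K) ξ, log j (mu K (p ^ j) g ξ) = cyclotomicCharacterModPow K p j g * log j ξ) →
        ∀ k, ∀ v ∈ S, (D k).IsSelfOrthogonalAt
          (W.eisensteinTowerTriple (κ.unitTwist (-1)) hm S hpS hbad L hL hLS k).cond v

set_option synthInstance.maxHeartbeats 80000 in
/-- INPUT 2′ — **(Exact) at the places `v ∣ p`** in the LIMIT (memo HOME/p1/H4-EXACT-AT-P-PLAN §1(d)(f); (ANN-SAT) x9-p1-w4 g8 ⊕
(EXACT-REP) x9-p1-w2 g8): same binders as `Stmt.h4AtS`, conclusion = the two (Exact) hypotheses of w8's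
`Tower.levelCondition_mem_iff_forall_pairing_eq_zero` (p649469) for the `D`-indexed local towers at `v` with the strict-ordinary cores —
verbatim the `hExactY`/`hExactX` of `eisensteinTower_isSelfOrthogonalAt_of_mem` (p669585).  `Stmt.h4AtS` FOLLOWS from it
(`h4AtS_of_exactAtP`). -/
abbrev Stmt.exactAtP : Prop :=
  ∀ (N : ℕ) [NeZero N] (W : WeierstrassCurve ℚ) [W.IsGloballyMinimal] (K : Type) [Field K] [NumberField K]
    (p : ℕ) [Fact p.Prime] (κ : ZpExtension K p) (γ : Field.absoluteGaloisGroup K)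
    (hyp : CastellaGrossiLeeSkinner2022.Thm413Hypotheses N W K p κ γ),
    W.HasIrreducibleModPGaloisRep p → (W.baseChange K).HasIrreducibleModPGaloisRep p →
    haveI := hyp.isElliptic
    ∀ (S : Finset (HeightOneSpectrum (𝓞 K)))
      (hpS : ∀ v, ((p : ℕ) : 𝓞 K) ∈ v.asIdeal → v ∈ S)
      (hbad : ∀ v, v ∉ S → ((p : ℕ) : 𝓞 K) ∉ v.asIdeal → (W.baseChange K).HasGoodReductionAt v),
    (∀ v ∈ S, ((p : ℕ) : 𝓞 K) ∈ v.asIdeal ∨ ((N : ℕ) : 𝓞 K) ∈ v.asIdeal) →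
    (∀ (σ : K ≃ₐ[ℚ] K) (v : HeightOneSpectrum (𝓞 K)), σ • v ∈ S → v ∈ S) →
    ∃ m₆ : ℕ, ∀ (m : ℕ) (hm : 1 ≤ m), m₆ ≤ m →
      letI := IwasawaAlgebra.isDomain_quotient_X_pow_add_C p hm
      letI := IwasawaAlgebra.isDiscreteValuationRing_quotient_X_pow_add_C p hm
      haveI := IwasawaAlgebra.EisensteinCoeff.isLocalRing_succ p hm
      letI := IwasawaAlgebra.EisensteinCoeff.algebraOfSpecSucc p m
      haveI := W.isScalarTower_algebraOfSpecSucc (K := K) (p := p) (m := m)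
      letI := W.residueModuleSucc (K := K) (p := p) hm
      ∀ (L : Set (HeightOneSpectrum (𝓞 K)))
        (hL : L ⊆ (W.eisensteinTower (κ.unitTwist (-1)) hm).degreeTwoPrimes p) (hLS : ∀ v ∈ L, v ∉ S)
        (c₀ : absoluteGaloisGroup ℚ) (σ : K ≃ₐ[ℚ] K) (hσ₁ : σ ≠ 1) (hσ : σ * σ = 1)
        (hτl : IsLiftOfAut σ (absGaloisTransport (K := ℚ) (L := K) c₀).toRingEquiv)
        (hτ₂ : Function.Involutive (absGaloisTransport (K := ℚ) (L := K) c₀).toRingEquiv)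
        (D : ∀ k, DualityDatum p (ConjugationDatum.ofLifts σ hσ₁ hσ _ hτl hτ₂)
          ((W.eisensteinTower (κ.unitTwist (-1)) hm).ρ k) (IwasawaAlgebra.EisensteinCoeff p m (k + 1)))
        (e : ∀ j : ℕ, geomTorsion (W.baseChange K) ((p : ℤ) ^ j) →+ geomTorsion (W.baseChange K) ((p : ℤ) ^ j) →+
          MuCarrier K (p ^ j))
        (log : ∀ j : ℕ, MuCarrier K (p ^ j) →+ ZMod (p ^ j)),
        IsComplexConjugation (Rat.castHom ℝ) c₀ →
        (∀ x, (ConjugationDatum.ofLifts σ hσ₁ hσ _ hτl hτ₂).τ x = absGaloisTransport (K := ℚ) (L := K) c₀ x) →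
        (∀ k, (D k).e = ZpExtension.eisensteinDualityForm hm (k + 1)
          (conjPairing (e (k + 1)) ((ConjugationDatum.ofLifts σ hσ₁ hσ _ hτl hτ₂).isLift.torsionMap W _)
            (log (k + 1)))) →
        (∀ k (x y : EisensteinLevel p m (fun j ↦ geomTorsion (W.baseChange K) ((p : ℤ) ^ j)) (k + 1 + 1)),
          IwasawaAlgebra.EisensteinCoeff.reduce p m (Nat.le_succ (k + 1)) ((D (k + 1)).e x y) =
            (D k).e ((W.eisensteinTower (κ.unitTwist (-1)) hm).red k x) ((W.eisensteinTower (κ.unitTwist (-1)) hm).red k y)) →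
        (∀ j a, e j a a = 0) →
        (∀ j (g : absoluteGaloisGroup K) a b, e j (g • a) (g • b) = mu K (p ^ j) g (e j a b)) →
        (∀ j a b, e j ((ConjugationDatum.ofLifts σ hσ₁ hσ _ hτl hτ₂).isLift.torsionMap W _ a)
          ((ConjugationDatum.ofLifts σ hσ₁ hσ _ hτl hτ₂).isLift.torsionMap W _ b) = -e j a b) →
        (∀ j (a : geomTorsion (W.baseChange K) ((p : ℤ) ^ j)),
          (ConjugationDatum.ofLifts σ hσ₁ hσ _ hτl hτ₂).isLift.torsionMap W _
            ((ConjugationDatum.ofLifts σ hσ₁ hσ _ hτl hτ₂).isLift.torsionMap W _ a) = a) →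
        (∀ j, Function.Bijective (log j)) →
        (∀ j (g : absoluteGaloisGroup K) ξ, log j (mu K (p ^ j) g ξ) = cyclotomicCharacterModPow K p j g * log j ξ) →
        ∀ (k : ℕ) (v : HeightOneSpectrum (𝓞 K)), v ∈ S → ((p : ℕ) : 𝓞 K) ∈ v.asIdeal →
          (∀ η ∈ Tower.compatibleFamilies (H := fun j ↦ galoisCohomology (((ConjugationDatum.ofLifts σ hσ₁ hσ _ hτl hτ₂).twist ((W.eisensteinTower (κ.unitTwist (-1)) hm).ρ j)).toLocal (Sum.inr v)) 1)
              (fun j ↦ ContinuousRep.cohomologyMap (((ConjugationDatum.ofLifts σ hσ₁ hσ _ hτl hτ₂).twist ((W.eisensteinTower (κ.unitTwist (-1)) hm).ρ (j + 1))).toLocal (Sum.inr v))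
            (((ConjugationDatum.ofLifts σ hσ₁ hσ _ hτl hτ₂).twist ((W.eisensteinTower (κ.unitTwist (-1)) hm).ρ j)).toLocal (Sum.inr v)) ((W.eisensteinTower (κ.unitTwist (-1)) hm).red j).toAddMonoidHom
            continuous_of_discreteTopology (fun _ z => (W.eisensteinTower (κ.unitTwist (-1)) hm).red_equivariant j _ z) 1),
            (∀ ξ ∈ Tower.saturatedFamilies (H := fun j ↦ galoisCohomology (((W.eisensteinTower (κ.unitTwist (-1)) hm).ρ j).toLocal (Sum.inr v)) 1)
                (fun j ↦ ContinuousRep.cohomologyMap (((W.eisensteinTower (κ.unitTwist (-1)) hm).ρ (j + 1)).toLocal (Sum.inr v))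
            (((W.eisensteinTower (κ.unitTwist (-1)) hm).ρ j).toLocal (Sum.inr v)) ((W.eisensteinTower (κ.unitTwist (-1)) hm).red j).toAddMonoidHom
            continuous_of_discreteTopology (fun _ z => (W.eisensteinTower (κ.unitTwist (-1)) hm).red_equivariant j _ z) 1) p
                (fun j ↦ ((W.baseChange K).ordinaryFiltrationAt v (fun j ↦ (W.baseChange K).torsionGaloisModuleReduce p j) (fun _ _ ↦ rfl)).ordinaryCore hm (j + 1)),
              (D k).localCup (Sum.inr v) (ξ k) (η k) = 0) →
            ∃ η' : Π j, galoisCohomology (((ConjugationDatum.ofLifts σ hσ₁ hσ _ hτl hτ₂).twist ((W.eisensteinTower (κ.unitTwist (-1)) hm).ρ j)).toLocal (Sum.inr v)) 1,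
              η - p ^ (k + 1) • η' ∈ Tower.saturatedFamilies (H := fun j ↦ galoisCohomology (((ConjugationDatum.ofLifts σ hσ₁ hσ _ hτl hτ₂).twist ((W.eisensteinTower (κ.unitTwist (-1)) hm).ρ j)).toLocal (Sum.inr v)) 1)
                (fun j ↦ ContinuousRep.cohomologyMap (((ConjugationDatum.ofLifts σ hσ₁ hσ _ hτl hτ₂).twist ((W.eisensteinTower (κ.unitTwist (-1)) hm).ρ (j + 1))).toLocal (Sum.inr v))
            (((ConjugationDatum.ofLifts σ hσ₁ hσ _ hτl hτ₂).twist ((W.eisensteinTower (κ.unitTwist (-1)) hm).ρ j)).toLocal (Sum.inr v)) ((W.eisensteinTower (κ.unitTwist (-1)) hm).red j).toAddMonoidHom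
            continuous_of_discreteTopology (fun _ z => (W.eisensteinTower (κ.unitTwist (-1)) hm).red_equivariant j _ z) 1) p
                (fun j ↦ (((W.baseChange K).ordinaryFiltrationAt ((ConjugationDatum.ofLifts σ hσ₁ hσ _ hτl hτ₂).σ • v) (fun j ↦ (W.baseChange K).torsionGaloisModuleReduce p j) (fun _ _ ↦ rfl)).ordinaryCore hm (j + 1)).map
            ((ConjugationDatum.ofLifts σ hσ₁ hσ _ hτl hτ₂).transportH1 ((κ.unitTwist (-1)).eisensteinTwist ((W.baseChange K).torsionGaloisModule ((p : ℤ) ^ (j + 1))) hm (j + 1)) v))) ∧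
          (∀ ξ ∈ Tower.compatibleFamilies (H := fun j ↦ galoisCohomology (((W.eisensteinTower (κ.unitTwist (-1)) hm).ρ j).toLocal (Sum.inr v)) 1)
              (fun j ↦ ContinuousRep.cohomologyMap (((W.eisensteinTower (κ.unitTwist (-1)) hm).ρ (j + 1)).toLocal (Sum.inr v))
            (((W.eisensteinTower (κ.unitTwist (-1)) hm).ρ j).toLocal (Sum.inr v)) ((W.eisensteinTower (κ.unitTwist (-1)) hm).red j).toAddMonoidHom
            continuous_of_discreteTopology (fun _ z => (W.eisensteinTower (κ.unitTwist (-1)) hm).red_equivariant j _ z) 1),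
            (∀ η ∈ Tower.saturatedFamilies (H := fun j ↦ galoisCohomology (((ConjugationDatum.ofLifts σ hσ₁ hσ _ hτl hτ₂).twist ((W.eisensteinTower (κ.unitTwist (-1)) hm).ρ j)).toLocal (Sum.inr v)) 1)
                (fun j ↦ ContinuousRep.cohomologyMap (((ConjugationDatum.ofLifts σ hσ₁ hσ _ hτl hτ₂).twist ((W.eisensteinTower (κ.unitTwist (-1)) hm).ρ (j + 1))).toLocal (Sum.inr v))
            (((ConjugationDatum.ofLifts σ hσ₁ hσ _ hτl hτ₂).twist ((W.eisensteinTower (κ.unitTwist (-1)) hm).ρ j)).toLocal (Sum.inr v)) ((W.eisensteinTower (κ.unitTwist (-1)) hm).red j).toAddMonoidHom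
            continuous_of_discreteTopology (fun _ z => (W.eisensteinTower (κ.unitTwist (-1)) hm).red_equivariant j _ z) 1) p
                (fun j ↦ (((W.baseChange K).ordinaryFiltrationAt ((ConjugationDatum.ofLifts σ hσ₁ hσ _ hτl hτ₂).σ • v) (fun j ↦ (W.baseChange K).torsionGaloisModuleReduce p j) (fun _ _ ↦ rfl)).ordinaryCore hm (j + 1)).map
            ((ConjugationDatum.ofLifts σ hσ₁ hσ _ hτl hτ₂).transportH1 ((κ.unitTwist (-1)).eisensteinTwist ((W.baseChange K).torsionGaloisModule ((p : ℤ) ^ (j + 1))) hm (j + 1)) v)),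
              (D k).localCup (Sum.inr v) (ξ k) (η k) = 0) →
            ∃ ξ' : Π j, galoisCohomology (((W.eisensteinTower (κ.unitTwist (-1)) hm).ρ j).toLocal (Sum.inr v)) 1,
              ξ - p ^ (k + 1) • ξ' ∈ Tower.saturatedFamilies (H := fun j ↦ galoisCohomology (((W.eisensteinTower (κ.unitTwist (-1)) hm).ρ j).toLocal (Sum.inr v)) 1)
                (fun j ↦ ContinuousRep.cohomologyMap (((W.eisensteinTower (κ.unitTwist (-1)) hm).ρ (j + 1)).toLocal (Sum.inr v))
            (((W.eisensteinTower (κ.unitTwist (-1)) hm).ρ j).toLocal (Sum.inr v)) ((W.eisensteinTower (κ.unitTwist (-1)) hm).red j).toAddMonoidHom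
            continuous_of_discreteTopology (fun _ z => (W.eisensteinTower (κ.unitTwist (-1)) hm).red_equivariant j _ z) 1) p
                (fun j ↦ ((W.baseChange K).ordinaryFiltrationAt v (fun j ↦ (W.baseChange K).torsionGaloisModuleReduce p j) (fun _ _ ↦ rfl)).ordinaryCore hm (j + 1)))




set_option synthInstance.maxHeartbeats 80000 in
set_option maxHeartbeats 1600000 in
/-- **INPUT 2 from INPUT 2′**: `Stmt.h4AtS` (H.4 at every `v ∈ S`) follows from the (Exact) statement at the places `v ∣ p`
(`Stmt.exactAtP`) and the Poitou–Tate binder — by `eisensteinTower_isSelfOrthogonalAt_of_mem` (p669585) +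
`eisensteinTower_orthogonal_twistedFil_of_e_eq` (p670038) at `v ∣ p`, and `eisensteinTower_isSelfOrthogonalAt_of_mem_of_not_mem_ofLifts`
(p667328) + (N1) p657002 + `decomp_not_le_kerSubgroup_of_mem_or_mem` at `v ∤ p` (threshold `max_v 2N_v`). -/
theorem h4AtS_of_exactAtP (hPT : Stmt.poitouTate) (HE : Stmt.exactAtP) : Stmt.h4AtS := by
  intro N _ W _ K _ _ p _ κ γ hyp hirr hirrK
  haveI := hyp.isElliptic
  intro S hpS hbad hSN hSσ
  classical
  have hK : IsImaginaryQuadratic K := hyp.isImaginaryQuadratic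
  have hanti : (κ.unitTwist (-1)).IsAnticyclotomic := hyp.anticyclotomic.unitTwist (-1)
  have hHeeg : SatisfiesHeegnerHypothesis N K := hyp.heegner
  have hN0 : N ≠ 0 := NeZero.ne N
  have hdec : ∀ v ∈ S, ((p : ℕ) : 𝓞 K) ∉ v.asIdeal → ¬ (GreenbergSelmer.decomp v ≤ (κ.unitTwist (-1)).kerSubgroup) :=
    fun v hv _ ↦ ZpExtension.decomp_not_le_kerSubgroup_of_mem_or_mem hK (κ.unitTwist (-1)) hanti hHeeg hN0 hSN v hv
  -- the (N1) bounds at the places of `S` prime to `p` (dummy elsewhere)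
  have hvN : ∀ v ∈ S, ((p : ℕ) : 𝓞 K) ∉ v.asIdeal →
      ∃ Nv : ℕ, 1 ≤ Nv ∧ ∀ (m : ℕ) (hm : 1 ≤ m), 2 * Nv < m → ∀ (j : ℕ)
        (x : galoisCohomology (GaloisRep.toLocal v
          ((κ.unitTwist (-1)).eisensteinTwist ((W.baseChange K).torsionGaloisModule ((p : ℤ) ^ j)) hm j)) 1), p ^ (8 * Nv) • x = 0 :=
    fun v hvS hpv ↦ exists_forall_pow_smul_galoisCohomology_one_toLocal_eq_zero_uniform v (W.baseChange K) (κ.unitTwist (-1)) hpv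
      (hdec v hvS hpv)
  choose! Nv hNv using hvN
  obtain ⟨m₆, h6⟩ := HE N W K p κ γ hyp hirr hirrK S hpS hbad hSN hSσ
  refine ⟨max (S.sup (fun v ↦ 2 * Nv v) + 1) m₆, fun m hm hle L hL hLS c₀ σ hσ₁ hσ hτl hτ₂ D e log hc₀ hτ hDe he_red
    h4' h5' h6' h7' h8' h9' k v hvS ↦ ?_⟩
  have hm6 : m₆ ≤ m := le_trans (le_max_right _ _) hle
  have hsup : S.sup (fun v ↦ 2 * Nv v) < m :=
    Nat.lt_of_lt_of_le (Nat.lt_succ_self _) (le_trans (le_max_left _ _) hle)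
  letI := IwasawaAlgebra.isDomain_quotient_X_pow_add_C p hm
  letI := IwasawaAlgebra.isDiscreteValuationRing_quotient_X_pow_add_C p hm
  haveI := IwasawaAlgebra.EisensteinCoeff.isLocalRing_succ p hm
  letI := IwasawaAlgebra.EisensteinCoeff.algebraOfSpecSucc p m
  haveI := W.isScalarTower_algebraOfSpecSucc (K := K) (p := p) (m := m)
  letI := W.residueModuleSucc (K := K) (p := p) hm
  by_cases hpv : ((p : ℕ) : 𝓞 K) ∈ v.asIdeal
  · -- `v ∣ p`: (Exact) + module isotropy
    have hσpv : ((p : ℕ) : 𝓞 K) ∈ ((ConjugationDatum.ofLifts σ hσ₁ hσ _ hτl hτ₂).σ • v).asIdeal :=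
      (WeierstrassCurve.natCast_mem_smul_asIdeal_iff (K := K) (p := p) σ v).2 hpv
    obtain ⟨hEY, hEX⟩ := h6 m hm hm6 L hL hLS c₀ σ hσ₁ hσ hτl hτ₂ D e log hc₀ hτ hDe he_red h4' h5' h6' h7' h8' h9' k v hvS hpv
    exact W.eisensteinTower_isSelfOrthogonalAt_of_mem (κ.unitTwist (-1)) hm S hpS hbad L hL hLS (ConjugationDatum.ofLifts σ hσ₁ hσ _ hτl hτ₂) D he_red (hPT K) k hpv hσpv
      (W.eisensteinTower_orthogonal_twistedFil_of_e_eq (κ.unitTwist (-1)) hm σ hσ₁ hσ _ hτl hτ₂ hyp.ordinary D e log hDe h4' h8' h7' hpv)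
      hEY hEX
  · -- `v ∤ p`: the torsion descent with the (N1) bounds at `v` and `σ•v`
    have hσvS : σ • v ∈ S := hSσ σ _ (by rwa [smul_smul, hσ, one_smul])
    have hσpv : ((p : ℕ) : 𝓞 K) ∉ (σ • v).asIdeal := fun h ↦
      hpv ((WeierstrassCurve.natCast_mem_smul_asIdeal_iff (K := K) (p := p) σ v).1 h)
    have h2v : 2 * Nv v < m := lt_of_le_of_lt (Finset.le_sup (f := fun v ↦ 2 * Nv v) hvS) hsup
    have h2σv : 2 * Nv (σ • v) < m := lt_of_le_of_lt (Finset.le_sup (f := fun v ↦ 2 * Nv v) hσvS) hsup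
    exact W.eisensteinTower_isSelfOrthogonalAt_of_mem_of_not_mem_ofLifts (κ.unitTwist (-1)) hm S hpS hbad L hL hLS σ hσ₁ hσ _ hτl hτ₂ D
      he_red (hPT K) k hpv hvS hσpv hσvS
      (fun j x ↦ (hNv v hvS hpv).2 m hm h2v (j + 1) x) (fun j x ↦ (hNv (σ • v) hσvS hσpv).2 m hm h2σv (j + 1) x)


/-- **Poitou–Tate duality for Selmer structures is a theorem of the tree** (the conjugation-compatible fact of
`Theorems/PoitouTateSelmerStructureDualityConjHolds`, forgetting the fifth conjunct). -/
theorem poitouTate_holds : Stmt.poitouTate := fun K _ _ ↦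
  poitouTate_selmerStructure_duality_of_conj (InputsPoitouTateSelmer.poitouTate_selmerStructure_duality_conj_holds K)

/-- **`Stmt.h4AtS` from (Exact) at `v ∣ p` alone** (the Poitou–Tate binder discharged). -/
theorem h4AtS_of_exactAtP' (HE : Stmt.exactAtP) : Stmt.h4AtS :=
  h4AtS_of_exactAtP poitouTate_holds HE

end Summit.BirchSwinnertonDyer.BirchSwinnertonDyer.Theorems.HeegnerMuPartH4AtS
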